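import Literature.NumberTheory.Automorphic.RankinSelbergUnfoldingRealPoint
import Literature.NumberTheory.Automorphic.RankinSelbergUnfoldingPairs
import HarnessLib

/-!
# The unfolding of the Rankin–Selberg integral of a PAIR at a real point:
`I(σ; φ̄₂, φ₁, Φ) = C · Ψ(σ; W_{φ₁}, W̄_{φ₂}, Φ)` (Cogdell (2004), Thm. 2.1, by polarization)

Topic `NumberTheory/Automorphic`; namespace `Literature.NumberTheory.Automorphic`. Proof file (theorems
only: no definition, no named fact, no instance). `RankinSelbergUnfoldingRealPoint` assembles the basic
identity of the Rankin–Selberg method at a real point `σ > 1` for ONE smoothed cusp form against its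
conjugate, `I(σ; φ̄, φ, Φ) = (C · Ψ(σ; W_φ, W̄_φ, Φ)).toReal` (Jacquet–Shalika (1981), §4; Cogdell (2004),
Thm. 2.1), using of the cuspidal representation `π ∋ f` only that `|S_η f|²` is invariant under the centre
(the central character). This file first records that identity for every `f ∈ L²_cusp` whose smoothing
has centrally invariant modulus (`exists_rankinSelbergIntegral_eq_of_norm_invariant`, the same proof,
together with the finiteness `∫ |S_η f|² E_X dμ' = C Ψ` in `[0, ∞]` and the reality of the descended
Eisenstein series), and then **polarizes** it: for `f₁ ∈ π₁`, `f₂ ∈ π₂` cuspidal transforming under the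
centre `Z(𝔸_K)` by the SAME unitary scalars (`ω_{π₁} = ω_{π₂}`; for `π₂ = σ̄` this is `ω_π ω_σ = 1`, the
only pairs the trivial-character mirabolic Eisenstein series of the tree can see), the four forms
`f₁ + c f₂`, `c ∈ {1, -1, i, -i}`, have centrally invariant modulus, and the polarization identity
`x ȳ = ¼ Σ_c c |x + c y|²` on both sides gives

  `I(σ; S̄_η f₂, S_η f₁, Φ) = C · Ψ(σ; W_{φ₁}, W̄_{φ₂}, Φ)`

(`exists_rankinSelbergIntegral_star_eq_mul_rankinSelbergTorusPairIntegral`, **main**), with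
`Ψ(σ; W, W', Φ) = rankinSelbergTorusPairIntegral νA νK W W' Φ σ` the unfolded integral of the pair
(`RankinSelbergUnfoldingPairs`) — Cogdell's `I(s; φ, φ', Φ) = Ψ(s; W_φ, W'_{φ'}, Φ)` for the pair
`(S_η f₁, S̄_η f₂)` at a real point, the input of the Euler factorisation of `RankinSelbergTorusPairEuler`
(`Ψ = L^{S'}(σ, π × π') · Ψ_{S'}`) for `L(s, π × π')` with `π' ≇ π̃` (Cogdell, Thm. 2.2, §4.2;
Mœglin–Waldspurger (1989), Appendice, Corollaire (i)(b)). Finiteness of the two unfolded integrals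
`Ψ(σ; W_{φⱼ}, W̄_{φⱼ}, Φ)` is a hypothesis (for test functions `η` and the standard `Φ` it is
`rankinSelbergTorusIntegral_whittakerCoeff_ne_top`).

## References

* J. W. Cogdell, *Analytic theory of L-functions for GL_n*, in *An Introduction to the Langlands
  Program* (2004), §2.3 Thm. 2.1 [CogdellAnalyticTheory2004].
* H. Jacquet, J. A. Shalika, *On Euler products and the classification of automorphic
  representations I*, Amer. J. Math. 103 (1981), §4, (4.4)–(4.6) [JacquetShalikaAJM1981].
-/

noncomputable section

open MeasureTheory Measure NumberField IsDedekindDomain Matrix Set Filter Topology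
open scoped ENNReal NNReal ComplexConjugate

namespace Literature.NumberTheory.Automorphic

open Literature.NumberTheory.GaloisRepresentations (ideleGroup)
open Literature.MeasureTheory.Group (coveringSum IsCoveringWeight)

attribute [-instance] Quotient.instMeasurableSpace QuotientGroup.measurableSpace

section RealPoint

variable {n : ℕ} {K : Type} [Field K] [NumberField K]
variable [MeasurableSpace (AdeleRing (𝓞 K) K)] [BorelSpace (AdeleRing (𝓞 K) K)]

-- the house local instances, exactly as in `RankinSelbergUnfoldingRealPoint`
attribute [local instance] adelicBorel borelSpace_adelic locallyCompactSpace_adelic secondCountableTopology_gl_adelic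
  glAdeleBorel borelSpace_glAdele borelSpace_ideleGroup

/-- **The Rankin–Selberg integral at a real point unfolds to the torus integral, for every `L²` cusp
form with centrally invariant smoothed modulus** (the statement of
`exists_rankinSelbergIntegral_ofReal_eq_mul_toReal_rankinSelbergTorusIntegral` with the cuspidal
representation replaced by what its proof uses: `f ∈ L²_cusp` and `‖S_η f((z 1_n) g)‖ = ‖S_η f(g)‖`),
together with the same identity in `[0, ∞]` — `∫ E_X |S_η f|² dμ' = C · Ψ(σ; W_φ, W̄_φ, Φ)` — and the reality
of the descended Eisenstein series at a real point. Same proof (Jacquet–Shalika (1981), §4; Cogdell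
(2004), Thm. 2.1). [cite: CogdellAnalyticTheory2004, §2.3 Thm. 2.1] -/
theorem exists_rankinSelbergIntegral_eq_of_norm_invariant (hn : 0 < n)
    (μ' : Measure (AdelicGroupData.gl n K).automorphicQuotient) [(AdelicGroupData.gl n K).IsAutomorphicMeasure μ']
    (νI : Measure (ideleGroup K)) [νI.IsHaarMeasure]
    (νA : Measure (Fin n → ideleGroup K)) [IsHaarMeasure νA]
    (νK : Measure ↥(maximalCompactAdelic n K)) [IsHaarMeasure νK]
    (ν₀ : Measure ↥(adelicUnipotent n K)) [IsHaarMeasure ν₀] :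
    ∃ C : ℝ≥0∞, C ≠ 0 ∧ C ≠ ⊤ ∧
      ∀ {f : (AdelicGroupData.gl n K).L2 μ'}, f ∈ cuspidalSubspace n K μ' →
      ∀ {η : (AdelicGroupData.gl n K).Adelic → ℝ}, Continuous η → HasCompactSupport η →
        (∀ (z : ideleGroup K) (g : GL (Fin n) (AdeleRing (𝓞 K) K)),
          ‖smoothedForm η f ((AdelicGroupData.gl n K).toAutomorphicQuotient (Matrix.GeneralLinearGroup.scalar (Fin n) z * g))‖ =
            ‖smoothedForm η f ((AdelicGroupData.gl n K).toAutomorphicQuotient g)‖) →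
      ∀ {Φ : (Fin n → AdeleRing (𝓞 K) K) → ℝ}, (fun x => (Φ x : ℂ)) ∈ piSchwartzBruhat K (Fin n) →
        (∀ x, 0 ≤ Φ x) → (Measurable fun g : GL (Fin n) (AdeleRing (𝓞 K) K) => Φ (lastRow n K g)) →
      ∀ {σ : ℝ}, 1 < σ →
        (∀ x, mirabolicEisensteinQuot νI (fun x => (Φ x : ℂ)) (σ : ℂ) x =
          (((mirabolicEisensteinQuot νI (fun x => (Φ x : ℂ)) (σ : ℂ) x).re : ℝ) : ℂ) ∧
          0 ≤ (mirabolicEisensteinQuot νI (fun x => (Φ x : ℂ)) (σ : ℂ) x).re) ∧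
        (∫⁻ x, ENNReal.ofReal (mirabolicEisensteinQuot νI (fun x => (Φ x : ℂ)) (σ : ℂ) x).re *
            ENNReal.ofReal (‖smoothedForm η f x‖ ^ 2) ∂μ' =
          C * rankinSelbergTorusIntegral n K νA νK
            (whittakerCoeff ν₀ (unipotentTateDomain n K) (adeleAddChar K)
              (invQuot (AdelicGroupData.gl n K) (smoothedForm η f))) Φ σ) ∧
        rankinSelbergIntegral μ' νI (fun x => (Φ x : ℂ)) (σ : ℂ) (star (smoothedForm η f)) (smoothedForm η f) =
          ((C * rankinSelbergTorusIntegral n K νA νK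
            (whittakerCoeff ν₀ (unipotentTateDomain n K) (adeleAddChar K)
              (invQuot (AdelicGroupData.gl n K) (smoothedForm η f))) Φ σ).toReal : ℂ) := by
  classical
  haveI : T2Space (GL (Fin n) (AdeleRing (𝓞 K) K)) := t2Space_gl n K
  haveI : LocallyCompactSpace (GL (Fin n) (AdeleRing (𝓞 K) K)) :=
    AdelicGroupData.locallyCompactSpace_generalLinearGroup_adeleRing K (Fin n)
  haveI : SecondCountableTopology (GL (Fin n) (AdeleRing (𝓞 K) K)) :=
    secondCountableTopology_generalLinearGroup_adeleRing K (Fin n)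
  set ν : Measure (GL (Fin n) (AdeleRing (𝓞 K) K)) := Measure.haar with hν
  haveI hνGL : IsHaarMeasure ν := by rw [hν]; infer_instance
  haveI hνgl : (show Measure (AdelicGroupData.gl n K).Adelic from ν).IsHaarMeasure := hνGL
  obtain ⟨C₁, hC₁0, hC₁t, h5⟩ := exists_lintegral_eisensteinLIntegral_mul_eq (n := n) (K := K) hn μ' ν νI
  obtain ⟨C₃, hC₃0, hC₃t, h3⟩ :=
    exists_mul_rankinSelbergTorusIntegral_eq_lintegral_eisensteinWeight (n := n) (K := K) hn ν νA νK ν₀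
  obtain ⟨𝓕, h𝓕⟩ := exists_isIdeleClassDomain K
  obtain ⟨βG, hβG⟩ := exists_isCoveringWeight_ratPoints (n := n) (K := K) (⊤ : Subgroup (GL (Fin n) K))
  refine ⟨C₁ * C₃, mul_ne_zero hC₁0 hC₃0, ENNReal.mul_ne_top hC₁t hC₃t,
    fun {f} hf {η} hη hηs hnorm {Φ} hΦS hΦ0 hΦm {σ} hσ => ?_⟩
  set φt : (AdelicGroupData.gl n K).automorphicQuotient → ℂ := smoothedForm η f with hφt
  set φ : GL (Fin n) (AdeleRing (𝓞 K) K) → ℂ := invQuot (AdelicGroupData.gl n K) φt with hφ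
  have hφtc : Continuous φt := continuous_smoothedForm hη hηs _
  have hφc : Continuous φ := continuous_invQuot_smoothedForm hη hηs _
  have hφK : ∀ (γ₀ : GL (Fin n) K) (x : GL (Fin n) (AdeleRing (𝓞 K) K)),
      φ (Matrix.GeneralLinearGroup.map (algebraMap K (AdeleRing (𝓞 K) K)) γ₀ * x) = φ x :=
    fun γ₀ x => isLeftInvariant_invQuot _ φt _ ⟨γ₀, rfl⟩ x
  have hcusp : ∀ k, 0 < k → k < n → CuspConditionGL n K φ k := fun k hk hkn =>
    cuspConditionGL_invQuot_smoothedForm hη hηs hf hk hkn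
  have hΦc : Continuous Φ := by
    have h : Continuous fun x => ((Φ x : ℂ)).re := Complex.continuous_re.comp (continuous_of_mem_piSchwartzBruhat hΦS)
    simpa only [Complex.ofReal_re] using h
  set W : GL (Fin n) (AdeleRing (𝓞 K) K) → ℝ≥0∞ := eisensteinWeight n K Φ σ with hW
  have hWm : Measurable W := measurable_eisensteinWeight
    (fun v => (hΦc.comp (continuous_const.matrix_vecMul Units.continuous_val)).measurable) σ
  have hWK : ∀ (γ : GL (Fin n) K) (g : GL (Fin n) (AdeleRing (𝓞 K) K)),
      W (Matrix.GeneralLinearGroup.map (algebraMap K (AdeleRing (𝓞 K) K)) γ * g) = W g :=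
    fun γ g => eisensteinWeight_map_mul Φ σ γ g
  set E : (AdelicGroupData.gl n K).automorphicQuotient → ℂ :=
    mirabolicEisensteinQuot νI (fun x => (Φ x : ℂ)) (σ : ℂ) with hE
  have hσ' : 1 < ((σ : ℂ)).re := by rwa [Complex.ofReal_re]
  have hEc : Continuous E := continuous_mirabolicEisensteinQuot_of_mem_piSchwartzBruhat K νI hΦS hσ'
  set EX : (AdelicGroupData.gl n K).automorphicQuotient → ℝ≥0∞ := fun x => ENNReal.ofReal (E x).re with hEX
  have hEXm : Measurable EX := ENNReal.measurable_ofReal.comp (Complex.continuous_re.comp hEc).measurable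
  have hEg : ∀ g : GL (Fin n) (AdeleRing (𝓞 K) K),
      (∫⁻ a in 𝓕, W (Matrix.GeneralLinearGroup.scalar (Fin n) a * g⁻¹) ∂νI) < ⊤ ∧
      E ((AdelicGroupData.gl n K).toAutomorphicQuotient g) =
        ((∫⁻ a in 𝓕, W (Matrix.GeneralLinearGroup.scalar (Fin n) a * g⁻¹) ∂νI).toReal : ℂ) := by
    intro g
    rw [hE, mirabolicEisensteinQuot_toAutomorphicQuotient]
    exact mirabolicEisenstein_ofReal_eq_toReal_setLIntegral_eisensteinWeight νI h𝓕 hΦS hΦ0 hσ g⁻¹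
  have hEXg : ∀ g : GL (Fin n) (AdeleRing (𝓞 K) K), EX ((AdelicGroupData.gl n K).toAutomorphicQuotient g) =
      ∫⁻ a in 𝓕, W (Matrix.GeneralLinearGroup.scalar (Fin n) a * g⁻¹) ∂νI := by
    intro g
    rw [hEX]
    simp only []
    rw [(hEg g).2, Complex.ofReal_re, ENNReal.ofReal_toReal (hEg g).1.ne]
  have hEre : ∀ x, E x = (((EX x).toReal : ℝ) : ℂ) := by
    intro x
    obtain ⟨g, rfl⟩ := (AdelicGroupData.gl n K).toAutomorphicQuotient_surjective x
    rw [hEXg, (hEg g).2]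
  have hEre' : ∀ x, E x = (((E x).re : ℝ) : ℂ) ∧ 0 ≤ (E x).re := fun x => by
    rw [hEre x, Complex.ofReal_re]
    exact ⟨rfl, ENNReal.toReal_nonneg⟩
  set F : (AdelicGroupData.gl n K).automorphicQuotient → ℝ≥0∞ := fun x => ENNReal.ofReal (‖φt x‖ ^ 2) with hF
  have hFm : Measurable F := ENNReal.measurable_ofReal.comp (hφtc.norm.pow 2).measurable
  have hFZ : ∀ (z : ideleGroup K) (g : GL (Fin n) (AdeleRing (𝓞 K) K)),
      F ((AdelicGroupData.gl n K).toAutomorphicQuotient (Matrix.GeneralLinearGroup.scalar (Fin n) z * g)) =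
        F ((AdelicGroupData.gl n K).toAutomorphicQuotient g) := by
    intro z g
    show ENNReal.ofReal (‖φt _‖ ^ 2) = ENNReal.ofReal (‖φt _‖ ^ 2)
    rw [hnorm z g]
  have hRS : rankinSelbergIntegral μ' νI (fun x => (Φ x : ℂ)) (σ : ℂ) (star φt) φt =
      ((∫⁻ x, EX x * F x ∂μ').toReal : ℂ) := by
    unfold rankinSelbergIntegral
    have hint : ∀ x, (star φt) x * φt x * mirabolicEisensteinQuot νI (fun x => (Φ x : ℂ)) (σ : ℂ) x =
        ((‖φt x‖ ^ 2 * (EX x).toReal : ℝ) : ℂ) := by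
      intro x
      rw [← hE, hEre x, Pi.star_apply, Complex.star_def, Complex.conj_mul', Complex.ofReal_mul]
      push_cast
      ring
    simp_rw [hint]
    have h0 : ∀ x, 0 ≤ ‖φt x‖ ^ 2 * (EX x).toReal := fun x => mul_nonneg (sq_nonneg _) ENNReal.toReal_nonneg
    have hm : AEStronglyMeasurable (fun x => ‖φt x‖ ^ 2 * (EX x).toReal) μ' :=
      ((hφtc.norm.pow 2).measurable.mul hEXm.ennreal_toReal).aestronglyMeasurable
    rw [show (∫ x, (((‖φt x‖ ^ 2 * (EX x).toReal : ℝ)) : ℂ) ∂μ') = ((∫ x, ‖φt x‖ ^ 2 * (EX x).toReal ∂μ' : ℝ) : ℂ)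
      from integral_ofReal, integral_eq_lintegral_of_nonneg_ae (Eventually.of_forall h0) hm]
    congr 2
    refine lintegral_congr fun x => ?_
    rw [ENNReal.ofReal_mul (sq_nonneg _), ENNReal.ofReal_toReal ENNReal.ofReal_ne_top, mul_comm]
  have h5' := h5 h𝓕 hWm hWK hFm hFZ hEXm hEXg hβG.1 hβG.2
  have h3' := h3 hφc hφK hcusp hΦ0 hΦm σ hβG.1 hβG.2
  have hG : (∫⁻ g : (AdelicGroupData.gl n K).Adelic,
      W g * βG g * F ((AdelicGroupData.gl n K).toAutomorphicQuotient g⁻¹)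
        ∂(ν : Measure (AdelicGroupData.gl n K).Adelic)) =
      C₃ * rankinSelbergTorusIntegral n K νA νK
        (whittakerCoeff ν₀ (unipotentTateDomain n K) (adeleAddChar K) φ) Φ σ := by
    rw [h3']
    show (∫⁻ x : GL (Fin n) (AdeleRing (𝓞 K) K),
      W x * βG x * F ((AdelicGroupData.gl n K).toAutomorphicQuotient x⁻¹) ∂ν) = _
    refine lintegral_congr fun g => ?_
    simp only [hF, hW, hφ, invQuot_apply]
    ring
  have hchain : ∫⁻ x, EX x * F x ∂μ' = C₁ * C₃ * rankinSelbergTorusIntegral n K νA νK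
      (whittakerCoeff ν₀ (unipotentTateDomain n K) (adeleAddChar K) φ) Φ σ :=
    h5'.trans ((congrArg (fun t => C₁ * t) hG).trans (mul_assoc _ _ _).symm)
  refine ⟨hEre', ?_, ?_⟩
  · rw [← hchain]
  · rw [hRS, hchain]

/-! ### Polarization: the pair identity -/

/-- **Polarization of a complex-weighted integral**: if the four functions `‖f + c g‖² w`,
`c ∈ {1, -1, i, -i}`, are integrable then `∫ f ḡ w = ¼ (∫ ‖f + g‖² w - ∫ ‖f - g‖² w + i ∫ ‖f + i g‖² w -
i ∫ ‖f - i g‖² w)` (here with a complex weight `w`). [folklore] -/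
theorem integral_mul_conj_mul_eq_polarization_complex {X : Type*} [MeasurableSpace X] {m : Measure X}
    {f g w : X → ℂ}
    (h₁ : Integrable (fun x => ((‖f x + g x‖ ^ 2 : ℝ) : ℂ) * w x) m)
    (h₂ : Integrable (fun x => ((‖f x - g x‖ ^ 2 : ℝ) : ℂ) * w x) m)
    (h₃ : Integrable (fun x => ((‖f x + Complex.I * g x‖ ^ 2 : ℝ) : ℂ) * w x) m)
    (h₄ : Integrable (fun x => ((‖f x - Complex.I * g x‖ ^ 2 : ℝ) : ℂ) * w x) m) :
    ∫ x, f x * conj (g x) * w x ∂m =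
      (1 / 4 : ℂ) * ((∫ x, ((‖f x + g x‖ ^ 2 : ℝ) : ℂ) * w x ∂m) - (∫ x, ((‖f x - g x‖ ^ 2 : ℝ) : ℂ) * w x ∂m) +
        Complex.I * (∫ x, ((‖f x + Complex.I * g x‖ ^ 2 : ℝ) : ℂ) * w x ∂m) -
          Complex.I * (∫ x, ((‖f x - Complex.I * g x‖ ^ 2 : ℝ) : ℂ) * w x ∂m)) := by
  have hpt : ∀ x, f x * conj (g x) * w x =
      (1 / 4 : ℂ) * ((((‖f x + g x‖ ^ 2 : ℝ) : ℂ) * w x - ((‖f x - g x‖ ^ 2 : ℝ) : ℂ) * w x) +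
        Complex.I * (((‖f x + Complex.I * g x‖ ^ 2 : ℝ) : ℂ) * w x) -
          Complex.I * (((‖f x - Complex.I * g x‖ ^ 2 : ℝ) : ℂ) * w x)) := by
    intro x
    rw [mul_conj_eq_polarization]
    ring
  simp_rw [hpt]
  have h₃' := h₃.const_mul Complex.I
  have h₄' := h₄.const_mul Complex.I
  have hA : Integrable (fun x => ((‖f x + g x‖ ^ 2 : ℝ) : ℂ) * w x - ((‖f x - g x‖ ^ 2 : ℝ) : ℂ) * w x) m := h₁.sub h₂
  have hB : Integrable (fun x => ((‖f x + g x‖ ^ 2 : ℝ) : ℂ) * w x - ((‖f x - g x‖ ^ 2 : ℝ) : ℂ) * w x +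
      Complex.I * (((‖f x + Complex.I * g x‖ ^ 2 : ℝ) : ℂ) * w x)) m := hA.add h₃'
  rw [integral_const_mul, integral_sub hB h₄', integral_add hA h₃', integral_sub h₁ h₂, integral_const_mul,
    integral_const_mul]

/-- The unfolded integral of `W₁ + c W₂` is finite when those of `W₁`, `W₂` are
(`‖a + c b‖² ≤ 2‖a‖² + 2‖c‖²‖b‖²`). [folklore] -/
theorem rankinSelbergTorusIntegral_add_smul_ne_top (νA : Measure (Fin n → ideleGroup K))
    (νK : Measure ↥(maximalCompactAdelic n K)) {W₁ W₂ : GL (Fin n) (AdeleRing (𝓞 K) K) → ℂ}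
    (hW₁ : Continuous W₁) (hW₂ : Continuous W₂) {Φ : (Fin n → AdeleRing (𝓞 K) K) → ℝ} (hΦ : ∀ y, 0 ≤ Φ y)
    (hΦm : Measurable fun g : GL (Fin n) (AdeleRing (𝓞 K) K) => Φ (lastRow n K g)) (σ : ℝ) (c : ℂ)
    (h₁ : rankinSelbergTorusIntegral n K νA νK W₁ Φ σ ≠ ⊤) (h₂ : rankinSelbergTorusIntegral n K νA νK W₂ Φ σ ≠ ⊤) :
    rankinSelbergTorusIntegral n K νA νK (fun g => W₁ g + c * W₂ g) Φ σ ≠ ⊤ := by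
  have hm₁ := measurable_torusIntegrand hW₁ hΦm σ
  have hm₂ := measurable_torusIntegrand hW₂ hΦm σ
  have hle : rankinSelbergTorusIntegral n K νA νK (fun g => W₁ g + c * W₂ g) Φ σ ≤
      2 * rankinSelbergTorusIntegral n K νA νK W₁ Φ σ +
        2 * ENNReal.ofReal (‖c‖ ^ 2) * rankinSelbergTorusIntegral n K νA νK W₂ Φ σ := by
    unfold rankinSelbergTorusIntegral
    calc ∫⁻ p, torusIntegrand n K (fun g => W₁ g + c * W₂ g) Φ σ p ∂(νA.prod νK)
        ≤ ∫⁻ p, (2 * torusIntegrand n K W₁ Φ σ p + 2 * ENNReal.ofReal (‖c‖ ^ 2) * torusIntegrand n K W₂ Φ σ p)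
            ∂(νA.prod νK) := by
          refine lintegral_mono fun p => ?_
          have hw : 0 ≤ Φ (lastRow n K (torusPoint n K p)) * torusWeight n K σ p.1 :=
            mul_nonneg (hΦ _) (torusWeight_nonneg σ p.1)
          have h0 : ‖W₁ (torusPoint n K p) + c * W₂ (torusPoint n K p)‖ ^ 2 ≤
              2 * ‖W₁ (torusPoint n K p)‖ ^ 2 + 2 * (‖c‖ ^ 2 * ‖W₂ (torusPoint n K p)‖ ^ 2) := by
            have h1 : ‖W₁ (torusPoint n K p) + c * W₂ (torusPoint n K p)‖ ≤
                ‖W₁ (torusPoint n K p)‖ + ‖c‖ * ‖W₂ (torusPoint n K p)‖ :=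
              (norm_add_le _ _).trans (by rw [norm_mul])
            have h2 : 0 ≤ ‖W₁ (torusPoint n K p)‖ + ‖c‖ * ‖W₂ (torusPoint n K p)‖ := by positivity
            nlinarith [sq_nonneg (‖W₁ (torusPoint n K p)‖ - ‖c‖ * ‖W₂ (torusPoint n K p)‖),
              norm_nonneg (W₁ (torusPoint n K p) + c * W₂ (torusPoint n K p))]
          have hreal : ‖W₁ (torusPoint n K p) + c * W₂ (torusPoint n K p)‖ ^ 2 *
              Φ (lastRow n K (torusPoint n K p)) * torusWeight n K σ p.1 ≤
              2 * (‖W₁ (torusPoint n K p)‖ ^ 2 * Φ (lastRow n K (torusPoint n K p)) * torusWeight n K σ p.1) +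
                2 * ‖c‖ ^ 2 * (‖W₂ (torusPoint n K p)‖ ^ 2 * Φ (lastRow n K (torusPoint n K p)) *
                  torusWeight n K σ p.1) := by
            nlinarith [mul_le_mul_of_nonneg_right h0 hw]
          have hA : 0 ≤ 2 * (‖W₁ (torusPoint n K p)‖ ^ 2 * Φ (lastRow n K (torusPoint n K p)) * torusWeight n K σ p.1) := by
            nlinarith [hw, sq_nonneg ‖W₁ (torusPoint n K p)‖]
          have hB : 0 ≤ 2 * ‖c‖ ^ 2 * (‖W₂ (torusPoint n K p)‖ ^ 2 * Φ (lastRow n K (torusPoint n K p)) *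
              torusWeight n K σ p.1) := by
            nlinarith [hw, sq_nonneg ‖W₂ (torusPoint n K p)‖, sq_nonneg ‖c‖,
              mul_nonneg (sq_nonneg ‖c‖) (mul_nonneg (sq_nonneg ‖W₂ (torusPoint n K p)‖) hw)]
          calc torusIntegrand n K (fun g => W₁ g + c * W₂ g) Φ σ p
              = ENNReal.ofReal (‖W₁ (torusPoint n K p) + c * W₂ (torusPoint n K p)‖ ^ 2 *
                  Φ (lastRow n K (torusPoint n K p)) * torusWeight n K σ p.1) := rfl
            _ ≤ ENNReal.ofReal (2 * (‖W₁ (torusPoint n K p)‖ ^ 2 * Φ (lastRow n K (torusPoint n K p)) *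
                  torusWeight n K σ p.1) + 2 * ‖c‖ ^ 2 * (‖W₂ (torusPoint n K p)‖ ^ 2 *
                    Φ (lastRow n K (torusPoint n K p)) * torusWeight n K σ p.1)) := ENNReal.ofReal_le_ofReal hreal
            _ = _ := by
                unfold torusIntegrand
                rw [ENNReal.ofReal_add hA hB, ENNReal.ofReal_mul zero_le_two,
                  ENNReal.ofReal_mul (by positivity : (0 : ℝ) ≤ 2 * ‖c‖ ^ 2), ENNReal.ofReal_mul zero_le_two,
                  ENNReal.ofReal_ofNat]
      _ = _ := by
          rw [lintegral_add_left (hm₁.const_mul 2), lintegral_const_mul _ hm₁, lintegral_const_mul _ hm₂]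
  refine ne_top_of_le_ne_top ?_ hle
  exact ENNReal.add_ne_top.2 ⟨ENNReal.mul_ne_top ENNReal.ofNat_ne_top h₁,
    ENNReal.mul_ne_top (ENNReal.mul_ne_top ENNReal.ofNat_ne_top ENNReal.ofReal_ne_top) h₂⟩

/-- **The unfolding of the Rankin–Selberg integral of a PAIR at a real point** (Cogdell (2004), Thm. 2.1
`I(s; φ, φ', Φ) = Ψ(s; W_φ, W'_{φ'}, Φ)`; Jacquet–Shalika (1981), §4, (4.4)). There is a constant `C ∈ (0, ∞)`
depending only on the Haar measures such that for all `f₁, f₂ ∈ L²_cusp(GL_n(K) A_G \ GL_n(𝔸_K))` which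
transform under the centre `Z(𝔸_K)` by the **same** scalars of modulus one (`R(z 1_n) fⱼ = c_z fⱼ`,
`|c_z| = 1` — e.g. `f₁ ∈ π`, `f₂ ∈ σ̄` with `ω_π ω_σ = 1`), every continuous compactly supported weight
`η`, every real Schwartz–Bruhat `Φ ≥ 0` with `g ↦ Φ(e_n g)` measurable, and every real `σ > 1` at which the
two unfolded integrals `Ψ(σ; W_{φⱼ}, W̄_{φⱼ}, Φ)` are finite (`φⱼ = invQuot (S_η fⱼ)`, `W_{φⱼ}` their global
Whittaker coefficients):

  `I(σ; S̄_η f₂, S_η f₁, Φ) = C · Ψ(σ; W_{φ₁}, W̄_{φ₂}, Φ)`,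

i.e. `rankinSelbergIntegral μ' ν_I Φ σ (star (S_η f₂)) (S_η f₁) = C.toReal · rankinSelbergTorusPairIntegral νA νK
W_{φ₁} (star W_{φ₂}) Φ σ`. Proof: the one-form identity (`exists_rankinSelbergIntegral_eq_of_norm_invariant`)
for the four forms `f₁ + c f₂`, `c ∈ {1, -1, i, -i}` (centrally invariant modulus), `S_η` and `W` being
linear, and the polarization identity on both sides. [cite: CogdellAnalyticTheory2004, §2.3 Thm. 2.1] -/
theorem exists_rankinSelbergIntegral_star_eq_mul_rankinSelbergTorusPairIntegral (hn : 0 < n)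
    (μ' : Measure (AdelicGroupData.gl n K).automorphicQuotient) [(AdelicGroupData.gl n K).IsAutomorphicMeasure μ']
    (νI : Measure (ideleGroup K)) [νI.IsHaarMeasure]
    (νA : Measure (Fin n → ideleGroup K)) [IsHaarMeasure νA]
    (νK : Measure ↥(maximalCompactAdelic n K)) [IsHaarMeasure νK]
    (ν₀ : Measure ↥(adelicUnipotent n K)) [IsHaarMeasure ν₀] :
    ∃ C : ℝ≥0∞, C ≠ 0 ∧ C ≠ ⊤ ∧
      ∀ {f₁ f₂ : (AdelicGroupData.gl n K).L2 μ'}, f₁ ∈ cuspidalSubspace n K μ' → f₂ ∈ cuspidalSubspace n K μ' →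
        (∀ z : ideleGroup K, ∃ c : ℂ, ‖c‖ = 1 ∧
          (AdelicGroupData.gl n K).rightRegular μ' (Matrix.GeneralLinearGroup.scalar (Fin n) z) f₁ = c • f₁ ∧
          (AdelicGroupData.gl n K).rightRegular μ' (Matrix.GeneralLinearGroup.scalar (Fin n) z) f₂ = c • f₂) →
      ∀ {η : (AdelicGroupData.gl n K).Adelic → ℝ}, Continuous η → HasCompactSupport η →
      ∀ {Φ : (Fin n → AdeleRing (𝓞 K) K) → ℝ}, (fun x => (Φ x : ℂ)) ∈ piSchwartzBruhat K (Fin n) →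
        (∀ x, 0 ≤ Φ x) → (Measurable fun g : GL (Fin n) (AdeleRing (𝓞 K) K) => Φ (lastRow n K g)) →
      ∀ {σ : ℝ}, 1 < σ →
        rankinSelbergTorusIntegral n K νA νK (whittakerCoeff ν₀ (unipotentTateDomain n K) (adeleAddChar K)
          (invQuot (AdelicGroupData.gl n K) (smoothedForm η f₁))) Φ σ ≠ ⊤ →
        rankinSelbergTorusIntegral n K νA νK (whittakerCoeff ν₀ (unipotentTateDomain n K) (adeleAddChar K)
          (invQuot (AdelicGroupData.gl n K) (smoothedForm η f₂))) Φ σ ≠ ⊤ →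
        rankinSelbergIntegral μ' νI (fun x => (Φ x : ℂ)) (σ : ℂ) (star (smoothedForm η f₂)) (smoothedForm η f₁) =
          (((C.toReal : ℝ)) : ℂ) * rankinSelbergTorusPairIntegral n K νA νK
            (whittakerCoeff ν₀ (unipotentTateDomain n K) (adeleAddChar K)
              (invQuot (AdelicGroupData.gl n K) (smoothedForm η f₁)))
            (star (whittakerCoeff ν₀ (unipotentTateDomain n K) (adeleAddChar K)
              (invQuot (AdelicGroupData.gl n K) (smoothedForm η f₂)))) Φ σ := by
  classical
  haveI : T2Space (GL (Fin n) (AdeleRing (𝓞 K) K)) := t2Space_gl n K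
  haveI : LocallyCompactSpace (GL (Fin n) (AdeleRing (𝓞 K) K)) :=
    AdelicGroupData.locallyCompactSpace_generalLinearGroup_adeleRing K (Fin n)
  haveI : SecondCountableTopology (GL (Fin n) (AdeleRing (𝓞 K) K)) :=
    secondCountableTopology_generalLinearGroup_adeleRing K (Fin n)
  obtain ⟨C, hC0, hCt, hT⟩ := exists_rankinSelbergIntegral_eq_of_norm_invariant (n := n) (K := K) hn μ' νI νA νK ν₀
  refine ⟨C, hC0, hCt, fun {f₁ f₂} hf₁ hf₂ hZ {η} hη hηs {Φ} hΦS hΦ0 hΦm {σ} hσ hfin₁ hfin₂ => ?_⟩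
  -- notation
  set Sη : (AdelicGroupData.gl n K).L2 μ' → (AdelicGroupData.gl n K).automorphicQuotient → ℂ :=
    fun f => smoothedForm η f with hSη
  set Wc : ((AdelicGroupData.gl n K).automorphicQuotient → ℂ) → GL (Fin n) (AdeleRing (𝓞 K) K) → ℂ :=
    fun ψ => whittakerCoeff ν₀ (unipotentTateDomain n K) (adeleAddChar K) (invQuot (AdelicGroupData.gl n K) ψ) with hWc
  set E : (AdelicGroupData.gl n K).automorphicQuotient → ℂ :=
    mirabolicEisensteinQuot νI (fun x => (Φ x : ℂ)) (σ : ℂ) with hE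
  set φ₁ := Sη f₁ with hφ₁
  set φ₂ := Sη f₂ with hφ₂
  -- the combinations `f₁ + c f₂`
  have hmem : ∀ c : ℂ, f₁ + c • f₂ ∈ cuspidalSubspace n K μ' := fun c =>
    Submodule.add_mem _ hf₁ (Submodule.smul_mem _ c hf₂)
  have hSc : ∀ c : ℂ, Sη (f₁ + c • f₂) = fun x => φ₁ x + c * φ₂ x := fun c => by
    funext x
    change smoothedForm η (f₁ + c • f₂) x = smoothedForm η f₁ x + c * smoothedForm η f₂ x
    rw [show f₁ + c • f₂ = f₁ - (-c) • f₂ by rw [neg_smul, sub_neg_eq_add]]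
    rw [smoothedForm_sub (μ := μ') hη hηs, smoothedForm_const_smul]
    ring
  -- central invariance of the modulus of `S_η (f₁ + c f₂)`
  have hnorm : ∀ (c : ℂ) (z : ideleGroup K) (g : GL (Fin n) (AdeleRing (𝓞 K) K)),
      ‖smoothedForm η (f₁ + c • f₂)
          ((AdelicGroupData.gl n K).toAutomorphicQuotient (Matrix.GeneralLinearGroup.scalar (Fin n) z * g))‖ =
        ‖smoothedForm η (f₁ + c • f₂) ((AdelicGroupData.gl n K).toAutomorphicQuotient g)‖ := by
    intro c z g
    obtain ⟨d, hd, hd₁, hd₂⟩ := hZ z⁻¹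
    set sc : ideleGroup K →* (AdelicGroupData.gl n K).Adelic := Matrix.GeneralLinearGroup.scalar (Fin n) with hsc
    have hw : sc z ∈ Subgroup.center (AdelicGroupData.gl n K).Adelic := generalLinearGroup_scalar_mem_center z
    have hR : (AdelicGroupData.gl n K).rightRegular μ' (sc z)⁻¹ (f₁ + c • f₂) = d • (f₁ + c • f₂) := by
      rw [← map_inv, map_add, map_smul,
        show (AdelicGroupData.gl n K).rightRegular μ' (sc z⁻¹) f₁ = d • f₁ from hd₁,
        show (AdelicGroupData.gl n K).rightRegular μ' (sc z⁻¹) f₂ = d • f₂ from hd₂, smul_add, smul_comm c d]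
    have key : ∀ x : (AdelicGroupData.gl n K).automorphicQuotient,
        smoothedForm η (f₁ + c • f₂) (sc z • x) = d * smoothedForm η (f₁ + c • f₂) x := fun x => by
      rw [smoothedForm_smul_of_mem_center η _ hw x, hR, smoothedForm_const_smul]
    have key' : ∀ g' : (AdelicGroupData.gl n K).Adelic,
        smoothedForm η (f₁ + c • f₂) ((AdelicGroupData.gl n K).toAutomorphicQuotient (sc z * g')) =
          d * smoothedForm η (f₁ + c • f₂) ((AdelicGroupData.gl n K).toAutomorphicQuotient g') := fun g' => by
      rw [← AdelicGroupData.smul_toAutomorphicQuotient]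
      exact key _
    exact (congrArg norm (key' g)).trans (by rw [norm_mul, hd, one_mul])
  -- the one-form identity for each combination
  have hQ : ∀ c : ℂ, (∀ x, E x = (((E x).re : ℝ) : ℂ) ∧ 0 ≤ (E x).re) ∧
      (∫⁻ x, ENNReal.ofReal (E x).re * ENNReal.ofReal (‖Sη (f₁ + c • f₂) x‖ ^ 2) ∂μ' =
        C * rankinSelbergTorusIntegral n K νA νK (Wc (Sη (f₁ + c • f₂))) Φ σ) ∧
      rankinSelbergIntegral μ' νI (fun x => (Φ x : ℂ)) (σ : ℂ) (star (Sη (f₁ + c • f₂))) (Sη (f₁ + c • f₂)) =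
        ((C * rankinSelbergTorusIntegral n K νA νK (Wc (Sη (f₁ + c • f₂))) Φ σ).toReal : ℂ) := fun c =>
    hT (hmem c) hη hηs (hnorm c) hΦS hΦ0 hΦm hσ
  have hEre : ∀ x, E x = (((E x).re : ℝ) : ℂ) := fun x => ((hQ 0).1 x).1
  have hE0 : ∀ x, 0 ≤ (E x).re := fun x => ((hQ 0).1 x).2
  have hSx : ∀ (c : ℂ) (x : (AdelicGroupData.gl n K).automorphicQuotient),
      Sη (f₁ + c • f₂) x = φ₁ x + c * φ₂ x := fun c x => by rw [hSc c]
  -- the Whittaker coefficients of the combinations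
  have hiq : ∀ c : ℂ, (invQuot (AdelicGroupData.gl n K) (Sη (f₁ + c • f₂)) : GL (Fin n) (AdeleRing (𝓞 K) K) → ℂ) =
      (invQuot (AdelicGroupData.gl n K) φ₁ : GL (Fin n) (AdeleRing (𝓞 K) K) → ℂ) +
        c • (invQuot (AdelicGroupData.gl n K) φ₂ : GL (Fin n) (AdeleRing (𝓞 K) K) → ℂ) := fun c => by
    funext g; simp only [invQuot_apply, Pi.add_apply, Pi.smul_apply, smul_eq_mul, hSx c]
  have hφ₁i : Continuous (invQuot (AdelicGroupData.gl n K) φ₁ : GL (Fin n) (AdeleRing (𝓞 K) K) → ℂ) :=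
    continuous_invQuot_smoothedForm hη hηs f₁
  have hφ₂i : Continuous (invQuot (AdelicGroupData.gl n K) φ₂ : GL (Fin n) (AdeleRing (𝓞 K) K) → ℂ) :=
    continuous_invQuot_smoothedForm hη hηs f₂
  have hW : ∀ c : ℂ, Wc (Sη (f₁ + c • f₂)) = fun g => Wc φ₁ g + c * Wc φ₂ g := fun c => by
    funext g
    exact (congrArg (fun ψ : GL (Fin n) (AdeleRing (𝓞 K) K) → ℂ =>
      whittakerCoeff ν₀ (unipotentTateDomain n K) (adeleAddChar K) ψ g) (hiq c)).trans
      (whittakerCoeff_add_const_smul ν₀ hφ₁i hφ₂i c g)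
  have hWx : ∀ (c : ℂ) (g : GL (Fin n) (AdeleRing (𝓞 K) K)), Wc (Sη (f₁ + c • f₂)) g = Wc φ₁ g + c * Wc φ₂ g :=
    fun c g => by rw [hW c]
  have hW₁c : Continuous (Wc φ₁) := continuous_whittakerCoeff (measurableSet_unipotentTateDomain (n := n) (K := K))
    (isCompact_closure_unipotentTateDomain (n := n) (K := K)) (continuous_adeleAddChar K) hφ₁i
  have hW₂c : Continuous (Wc φ₂) := continuous_whittakerCoeff (measurableSet_unipotentTateDomain (n := n) (K := K))
    (isCompact_closure_unipotentTateDomain (n := n) (K := K)) (continuous_adeleAddChar K) hφ₂i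
  have hWcc : ∀ c : ℂ, Continuous (Wc (Sη (f₁ + c • f₂))) := fun c => by
    rw [hW c]; exact hW₁c.add (continuous_const.mul hW₂c)
  -- finiteness of the four unfolded integrals and the four real identities
  have hfinc : ∀ c : ℂ, rankinSelbergTorusIntegral n K νA νK (Wc (Sη (f₁ + c • f₂))) Φ σ ≠ ⊤ := fun c => by
    rw [hW c]; exact rankinSelbergTorusIntegral_add_smul_ne_top νA νK hW₁c hW₂c hΦ0 hΦm σ c hfin₁ hfin₂
  -- left sides: `∫ ‖φ₁ + cφ₂‖² E`, right sides: `C.toReal ∫ ‖W₁ + cW₂‖² Φ w`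
  have hId : ∀ c : ℂ, ∫ x, ((‖φ₁ x + c * φ₂ x‖ ^ 2 : ℝ) : ℂ) * E x ∂μ' =
      ((C.toReal : ℝ) : ℂ) * ((∫ p, ‖Wc φ₁ (torusPoint n K p) + c * Wc φ₂ (torusPoint n K p)‖ ^ 2 *
        (Φ (lastRow n K (torusPoint n K p)) * torusWeight n K σ p.1) ∂(νA.prod νK) : ℝ) : ℂ) := fun c => by
    have h := (hQ c).2.2
    unfold rankinSelbergIntegral at h
    have hlhs : (fun x => (star (Sη (f₁ + c • f₂))) x * Sη (f₁ + c • f₂) x *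
        mirabolicEisensteinQuot νI (fun x => (Φ x : ℂ)) (σ : ℂ) x) = fun x => ((‖φ₁ x + c * φ₂ x‖ ^ 2 : ℝ) : ℂ) * E x := by
      funext x
      rw [Pi.star_apply, Complex.star_def, hSx c x, Complex.conj_mul', ← hE]
      norm_cast
    rw [hlhs, ENNReal.toReal_mul, toReal_rankinSelbergTorusIntegral_eq_integral νA νK (hWcc c) hΦ0 hΦm σ (hfinc c),
      Complex.ofReal_mul] at h
    simp only [hWx c] at h
    exact h
  -- integrability on both sides
  have hEc : Continuous E := continuous_mirabolicEisensteinQuot_of_mem_piSchwartzBruhat K νI hΦS (by rwa [Complex.ofReal_re])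
  have hintL : ∀ c : ℂ, Integrable (fun x => ((‖φ₁ x + c * φ₂ x‖ ^ 2 : ℝ) : ℂ) * E x) μ' := fun c => by
    have hfinlin : ∫⁻ x, ENNReal.ofReal (E x).re * ENNReal.ofReal (‖Sη (f₁ + c • f₂) x‖ ^ 2) ∂μ' ≠ ⊤ := by
      rw [(hQ c).2.1]; exact ENNReal.mul_ne_top hCt (hfinc c)
    have hmeas : Measurable fun x => ENNReal.ofReal (E x).re * ENNReal.ofReal (‖Sη (f₁ + c • f₂) x‖ ^ 2) :=
      (ENNReal.measurable_ofReal.comp (Complex.continuous_re.comp hEc).measurable).mul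
        (ENNReal.measurable_ofReal.comp ((continuous_smoothedForm hη hηs _).norm.pow 2).measurable)
    have hI := integrable_toReal_of_lintegral_ne_top hmeas.aemeasurable hfinlin
    have hI' : Integrable (fun x => ‖φ₁ x + c * φ₂ x‖ ^ 2 * (E x).re) μ' := by
      refine hI.congr (Eventually.of_forall fun x => ?_)
      change (ENNReal.ofReal (E x).re * ENNReal.ofReal (‖Sη (f₁ + c • f₂) x‖ ^ 2)).toReal = _
      rw [ENNReal.toReal_mul, ENNReal.toReal_ofReal (hE0 x), ENNReal.toReal_ofReal (sq_nonneg _), hSx c x, mul_comm]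
    have heq : (fun x => ((‖φ₁ x + c * φ₂ x‖ ^ 2 : ℝ) : ℂ) * E x) =
        fun x => ((‖φ₁ x + c * φ₂ x‖ ^ 2 * (E x).re : ℝ) : ℂ) := by
      funext x
      conv_lhs => rw [hEre x]
      rw [Complex.ofReal_mul]
    rw [heq]
    exact hI'.ofReal
  have hintR : ∀ c : ℂ, Integrable (fun p => ‖Wc φ₁ (torusPoint n K p) + c * Wc φ₂ (torusPoint n K p)‖ ^ 2 *
      (Φ (lastRow n K (torusPoint n K p)) * torusWeight n K σ p.1)) (νA.prod νK) := fun c => by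
    have h := integrable_toReal_torusIntegrand νA νK (hWcc c) hΦm σ (hfinc c)
    have h1 : (fun p => (torusIntegrand n K (Wc (Sη (f₁ + c • f₂))) Φ σ p).toReal) =
        fun p => ‖Wc φ₁ (torusPoint n K p) + c * Wc φ₂ (torusPoint n K p)‖ ^ 2 *
          (Φ (lastRow n K (torusPoint n K p)) * torusWeight n K σ p.1) := by
      funext p; rw [← norm_sq_mul_eq_toReal_torusIntegrand hΦ0, hWx c]
    rwa [h1] at h
  -- polarization on both sides
  have e1 := hintL 1; have e2 := hintL (-1); have e3 := hintL Complex.I; have e4 := hintL (-Complex.I)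
  have f1 := hintR 1; have f2 := hintR (-1); have f3 := hintR Complex.I; have f4 := hintR (-Complex.I)
  have r1 := hId 1; have r2 := hId (-1); have r3 := hId Complex.I; have r4 := hId (-Complex.I)
  simp only [one_mul, neg_mul, ← sub_eq_add_neg] at e1 e2 e3 e4 f1 f2 f3 f4 r1 r2 r3 r4
  have hL : rankinSelbergIntegral μ' νI (fun x => (Φ x : ℂ)) (σ : ℂ) (star φ₂) φ₁ =
      ∫ x, φ₁ x * conj (φ₂ x) * E x ∂μ' := by
    unfold rankinSelbergIntegral
    refine integral_congr_ae (Eventually.of_forall fun x => ?_)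
    change (star φ₂) x * φ₁ x * E x = _
    rw [Pi.star_apply, Complex.star_def]
    ring
  have hR : rankinSelbergTorusPairIntegral n K νA νK (Wc φ₁) (star (Wc φ₂)) Φ σ =
      ∫ p, Wc φ₁ (torusPoint n K p) * conj (Wc φ₂ (torusPoint n K p)) *
        ((Φ (lastRow n K (torusPoint n K p)) * torusWeight n K σ p.1 : ℝ) : ℂ) ∂(νA.prod νK) := by
    unfold rankinSelbergTorusPairIntegral torusPairIntegrand
    rfl
  change rankinSelbergIntegral μ' νI (fun x => (Φ x : ℂ)) (σ : ℂ) (star φ₂) φ₁ =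
    (((C.toReal : ℝ)) : ℂ) * rankinSelbergTorusPairIntegral n K νA νK (Wc φ₁) (star (Wc φ₂)) Φ σ
  rw [hL, hR, integral_mul_conj_mul_eq_polarization_complex e1 e2 e3 e4,
    integral_mul_conj_mul_eq_polarization f1 f2 f3 f4, r1, r2, r3, r4]
  ring

end RealPoint

end Literature.NumberTheory.Automorphic
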